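import Literature.Algebra.EuclideanLattices.Encoding
import HarnessLib

/-!
# Size of lattice instances proved: discharge of `LatticeInstance.length_encode_le`

Topic `Algebra/EuclideanLattices` (trunk Lattice, item `LatticeEncoding`), namespace
`Literature.Lattice`. Sibling proof file of `Encoding.lean` (which stays untouched: it is upstream of
the LLL / lattice-complexity / lattice-cryptography cluster). It DISCHARGES the two named size
facts of that file, for the Boolean encodings fixed there:

* `Literature.Lattice.LatticeInstance.length_encode_le_holds : LatticeInstance.length_encode_le` —
  there is an absolute constant `C` (we take `C = 18`) with
  `|encode B| ≤ C · (n + 1)² · (⌊log₂ (1 + max |B i j|)⌋ + 1)` for every `B ∈ ℤⁿˣⁿ`: the input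
  size of a lattice problem is polynomial in the dimension `n` and in the bit length of the
  largest basis entry (Micciancio–Goldwasser 2002, Ch. 1, the size of the input of lattice
  problems is the number of bits of the integer basis; Arora–Barak 2009, §0.1, representing
  integers, tuples and matrices as strings);
* `Literature.Lattice.length_encodeInt_le_holds : length_encodeInt_le` — `|encodeInt z| ≤ log₂ |z| + 7`.

The proofs are pure length bookkeeping on the combinators of `BoolEncodings.lean` /
`Encoding.lean`. By `LatticeInstance.encode_eq` and the definition of `listBool`,
`|encode ⟨n, B⟩| = (2 |encodeNat n| + 2) + (2 n² + 2) + Σ_{i,j} (2 |encodeInt (B i j)| + 2)`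
(`length_encodeNatSD`, `length_listBool_encode`), where `|encodeInt z| = |encodeNat |z|| + 4`
(`length_encodeInt_eq`) and Mathlib's little-endian binary numeral has
`|encodeNat m| = Nat.size m ≤ ⌊log₂ m⌋ + 1` digits (`length_encodeNat_eq_size`,
`length_encodeNat_le_log`). Bounding `|B i j| ≤ M = maxEntry` entrywise
(`LatticeInstance.length_entry_le`, `LatticeInstance.length_encode_basis_le`) and
`⌊log₂ n⌋ ≤ n` gives `|encode ⟨n, B⟩| ≤ 2 n² L + 12 n² + 2 n + 6 ≤ 18 (n + 1)² L` with
`L = ⌊log₂ (M + 1)⌋ + 1 ≥ 1`.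

## References

* D. Micciancio, S. Goldwasser, *Complexity of Lattice Problems: A Cryptographic Perspective*,
  Kluwer International Series in Engineering and Computer Science 671, Kluwer/Springer 2002,
  doi:10.1007/978-1-4615-0897-7, Ch. 1 (Basics), §1.2–1.3: computational lattice problems and
  the size of an instance [MicciancioGoldwasser2002].
* S. Arora, B. Barak, *Computational Complexity: A Modern Approach*, CUP 2009, §0.1
  (representing objects as strings) [AroraBarak2009].
* Mathlib `Mathlib/Computability/Encoding.lean` (`encodeNat`, `encodePosNum`),
  `Mathlib/Data/Num/Lemmas.lean` (`PosNum.size_to_nat`), `Mathlib/Data/Nat/Size.lean`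
  (`Nat.size_le`).
-/

namespace Literature.Algebra.EuclideanLattices

open _root_.Computability Literature.Computability.Complexity

/-! ### Lengths of the building blocks -/

/-- `|encodePosNum p|` is the number of binary digits of `p`. [folklore] -/
private theorem length_encodePosNum (p : PosNum) : (encodePosNum p).length = p.natSize := by
  induction p with
  | one => rfl
  | bit0 p ih => simp only [encodePosNum, List.length_cons, ih, PosNum.natSize]
  | bit1 p ih => simp only [encodePosNum, List.length_cons, ih, PosNum.natSize]

/-- `|encodeNat n| = Nat.size n` (number of binary digits; `0` for `n = 0`). [folklore] -/
private theorem length_encodeNat_eq_size (n : ℕ) : (encodeNat n).length = n.size := by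
  have h : ((n : Num) : ℕ) = n := Num.to_of_nat n
  unfold encodeNat encodeNum
  cases hn : (n : Num) with
  | zero =>
    rw [hn, Num.cast_zero'] at h
    subst h
    rfl
  | pos m =>
    rw [hn, Num.cast_pos] at h
    rw [← h, length_encodePosNum, ← PosNum.size_eq_natSize, PosNum.size_to_nat]

/-- `|encodeNat n| ≤ ⌊log₂ n⌋ + 1`. [folklore] -/
private theorem length_encodeNat_le_log (n : ℕ) : (encodeNat n).length ≤ Nat.log 2 n + 1 := by
  rw [length_encodeNat_eq_size]
  exact Nat.size_le.2 (Nat.lt_pow_succ_log_self one_lt_two n)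

/-- `|unaryEncodeNat k| = k`. [folklore] -/
private theorem length_unaryEncodeNat_eq (k : ℕ) : (unaryEncodeNat k).length = k := by
  induction k with
  | zero => rfl
  | succ k ih => simp [unaryEncodeNat, ih]

/-- Length of a `listBool` code: unary length header, then each component `boolPair`-framed
(`2 |e a| + 2` bits each). [folklore] -/
private theorem length_listBool_encode {α : Type} (e : Encoding α Bool) (l : List α) :
    (e.listBool.encode l).length =
      2 * l.length + 2 + (l.map fun a => 2 * (e.encode a).length + 2).sum := by
  have H : ∀ l : List α, (l.foldr (fun a acc => boolPair (e.encode a) acc) []).length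
      = (l.map fun a => 2 * (e.encode a).length + 2).sum := by
    intro l
    induction l with
    | nil => rfl
    | cons a l ih =>
      simp only [List.foldr_cons, length_boolPair, ih, List.map_cons, List.sum_cons]
  simp only [Encoding.listBool, length_boolPair, length_unaryEncodeNat_eq, H]

/-- A list sum of `K`-bounded terms is at most `|l| · K`. [folklore] -/
private theorem sum_map_le_length_mul {α : Type} (l : List α) (f : α → ℕ) (K : ℕ)
    (h : ∀ a ∈ l, f a ≤ K) : (l.map f).sum ≤ l.length * K := by
  induction l with
  | nil => simp
  | cons a l ih =>
    simp only [List.map_cons, List.sum_cons, List.length_cons]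
    have ha : f a ≤ K := h a (by simp)
    have hl : (l.map f).sum ≤ l.length * K := ih fun b hb => h b (by simp [hb])
    nlinarith [ha, hl]

/-- `|encodeNatSD n| = 2 |encodeNat n| + 2` (every binary digit doubled, terminator `01`;
Arora–Barak 2009, §0.1). [cite: AroraBarak2009, §0.1] -/
theorem length_encodeNatSD (n : ℕ) :
    (encodeNatSD n).length = 2 * (encodeNat n).length + 2 := by
  have h := length_boolPair (encodeNat n) []
  rw [boolPair_encodeNat, List.append_nil] at h
  simpa using h

/-- `|encodeInt z| = |encodeNat |z|| + 4` (doubled sign bit, separator `01`, binary digits of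
`|z|`; Arora–Barak 2009, §0.1). [cite: AroraBarak2009, §0.1] -/
theorem length_encodeInt_eq (z : ℤ) :
    (encodeInt z).length = (encodeNat z.natAbs).length + 4 := by
  change (boolPair (encodingBoolBool.encode (decide (z < 0))) (encodeNat z.natAbs)).length = _
  rw [length_boolPair]
  have : (encodingBoolBool.encode (decide (z < 0))).length = 1 := rfl
  omega

/-! ### The discharges -/

/-- **Discharge of `length_encodeInt_le`:** `|encodeInt z| ≤ ⌊log₂ |z|⌋ + 7` (in fact `+ 5`:
doubled sign bit, separator `01`, and the `≤ ⌊log₂ |z|⌋ + 1` binary digits of `|z|`;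
Arora–Barak 2009, §0.1). [cite: AroraBarak2009, §0.1] -/
theorem length_encodeInt_le_holds : length_encodeInt_le := by
  unfold length_encodeInt_le
  intro z
  rw [length_encodeInt_eq]
  have := length_encodeNat_le_log z.natAbs
  omega

/-- Each `boolPair`-framed entry of the basis matrix contributes at most
`2 (⌊log₂ (M + 1)⌋ + 1) + 10` bits to the code, `M = maxEntry` (Micciancio–Goldwasser 2002,
Ch. 1, size of the input). [cite: MicciancioGoldwasser2002, Ch. 1  §1.3  size of the input] -/
theorem LatticeInstance.length_entry_le (I : LatticeInstance) (i j : Fin I.n) :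
    2 * (encodeInt (I.basis i j)).length + 2 ≤ 2 * (Nat.log 2 (I.maxEntry + 1) + 1) + 10 := by
  have h1 := length_encodeInt_eq (I.basis i j)
  have h2 := length_encodeNat_le_log (I.basis i j).natAbs
  have h3 : Nat.log 2 (I.basis i j).natAbs ≤ Nat.log 2 (I.maxEntry + 1) :=
    Nat.log_mono_right ((I.natAbs_le_maxEntry i j).trans (Nat.le_succ _))
  omega

/-- The row-major code of the basis matrix `B ∈ ℤⁿˣⁿ` (unary length header `n²`, then the
`n²` framed entries) has length at most `2 n² + 2 + n² (2 (⌊log₂ (M + 1)⌋ + 1) + 10)`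
(Micciancio–Goldwasser 2002, Ch. 1, size of the input). [cite: MicciancioGoldwasser2002, Ch. 1  §1.3  size of the input] -/
theorem LatticeInstance.length_encode_basis_le (I : LatticeInstance) :
    ((encodingIntMatrixFin I.n).encode I.basis).length ≤
      2 * (I.n * I.n) + 2 + I.n * I.n * (2 * (Nat.log 2 (I.maxEntry + 1) + 1) + 10) := by
  change (encodingIntBool.listBool.encode (List.ofFn fun m : Fin (I.n * I.n) =>
    I.basis (finProdFinEquiv.symm m).1 (finProdFinEquiv.symm m).2)).length ≤ _
  rw [length_listBool_encode, List.length_ofFn]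
  refine Nat.add_le_add_left ?_ _
  have h := sum_map_le_length_mul (List.ofFn fun m : Fin (I.n * I.n) =>
      I.basis (finProdFinEquiv.symm m).1 (finProdFinEquiv.symm m).2)
    (fun a => 2 * (encodingIntBool.encode a).length + 2)
    (2 * (Nat.log 2 (I.maxEntry + 1) + 1) + 10) (by
      intro a ha
      obtain ⟨m, rfl⟩ := List.mem_ofFn.1 ha
      exact I.length_entry_le _ _)
  rwa [List.length_ofFn] at h

/-- **Discharge of `LatticeInstance.length_encode_le`** with the constant `C = 18`:
`|encode ⟨n, B⟩| = (2 |encodeNat n| + 2) + (2 n² + 2) + Σ_{i,j} (2 |encodeInt (B i j)| + 2)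
≤ 18 (n + 1)² (⌊log₂ (max |B i j| + 1)⌋ + 1)`, using `|encodeNat m| ≤ ⌊log₂ m⌋ + 1 ≤ m + 1`:
the size of a lattice instance is polynomial in the dimension and in the bit length of the
largest basis entry (Micciancio–Goldwasser 2002, Ch. 1, size of the input of lattice problems;
Arora–Barak 2009, §0.1). [cite: MicciancioGoldwasser2002, Ch. 1  §1.3  size of the input] -/
theorem LatticeInstance.length_encode_le_holds : LatticeInstance.length_encode_le := by
  unfold LatticeInstance.length_encode_le
  refine ⟨18, fun I => ?_⟩
  have hL : 1 ≤ Nat.log 2 (I.maxEntry + 1) + 1 := Nat.succ_le_succ (Nat.zero_le _)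
  have hhead : (encodeNatSD I.n).length ≤ 2 * (I.n + 1) + 2 := by
    rw [length_encodeNatSD]
    have := (length_encodeNat_le_log I.n).trans (Nat.succ_le_succ (Nat.log_le_self 2 I.n))
    omega
  have hmat := I.length_encode_basis_le
  have h1 : I.n * I.n ≤ I.n * I.n * (Nat.log 2 (I.maxEntry + 1) + 1) :=
    Nat.le_mul_of_pos_right _ hL
  have h2 : I.n ≤ I.n * (Nat.log 2 (I.maxEntry + 1) + 1) := Nat.le_mul_of_pos_right _ hL
  rw [I.encode_eq, List.length_append]
  nlinarith [hhead, hmat, h1, h2, hL, Nat.zero_le (I.n * I.n),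
    Nat.zero_le (I.n * (Nat.log 2 (I.maxEntry + 1) + 1))]

end Literature.Algebra.EuclideanLattices
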